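import Literature.Analysis.FunctionSpaces.LittlewoodPaleyKernel
import HarnessLib

/-!
# A smooth low-pass kernel on a Euclidean space: `g_κ = 𝓕⁻¹[χ(4ξ/κ)]`

Analysis/Fourier support file (everything **proved**; no named facts). For the canonical radial
cut-off `χ = FunctionSpaces.dyadicCutoff E` of the tree's Littlewood–Paley theory (`χ = 1` on
`‖η‖ ≤ 1`, `χ = 0` on `‖η‖ ≥ 2`) we study the low-pass symbol `ℓ(ξ) = χ(4ξ)` (`= 1` on
`‖ξ‖ ≤ 1/4`, `= 0` on `‖ξ‖ ≥ 1/2`) and its kernels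

* `lowPassKernelOne = Re 𝓕⁻¹ ℓ` (a real, even Schwartz function of integral `1`, `𝓕 g₁ = ℓ`),
* `lowPassKernel κ x = κ^d g₁(κ x)` (`d = dim E`), the `L¹`-normalised dilate: for `κ > 0` it is
  even, `∫ g_κ = 1`, `∫ |g_κ| = ∫ |g₁|` (`lowPassMass E`), `∫ ‖x‖² |g_κ(x)| dx = κ⁻² ∫ ‖x‖² |g₁|`
  (`lowPassMoment E`), and `𝓕 g_κ (ξ) = ℓ(ξ/κ)`, so `𝓕 g_κ = 1` on `‖ξ‖ ≤ κ/4` and `= 0` on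
  `‖ξ‖ ≥ κ/2`.

This is the smooth substitute for the sharp Fourier projection `P_{≤κ/2}` in the
Littlewood–Paley arguments of Buckmaster–Vicol (Ann. of Math. 189 (2019), App. B, proof of
Lemma B.1) and Luo–Titi (Calc. Var. 59 (2020), proof of Lemma 6): convolution with `g_κ` is
bounded on every `L^p` uniformly in `κ` (its kernel has `L¹` norm independent of `κ`) and
reproduces functions with spectrum in `‖ξ‖ ≤ κ/4`, while the second-moment bound
`∫ ‖x‖² |g_κ| ≲ κ⁻²` gives `‖a - g_κ ∗ a‖_∞ ≲ κ⁻² ‖D²a‖_∞` (used in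
`FluidPDE/TorusLpOperatorFactsProofs`). The construction copies the tree's dyadic block kernels
(`FunctionSpaces/LittlewoodPaleyKernel`: `Re 𝓕⁻¹` of a real even symbol is real) with a
continuous dilation parameter in place of `2^j`. Neighbours in the tree: the symbol IS the
Littlewood–Paley cut-off symbol `FunctionSpaces.lowFreqSymbol (-2)` (and `lowPassSymbolSchwartz`
is `FunctionSpaces.lowFreqSymbolSchwartz E (-2)`), so `lowPassKernelC = 𝓕⁻¹ℓ` is the `j = -2`
analogue of `FunctionSpaces.lowFreqZeroKernel` (`LittlewoodPaleyDifferenceProofs`) and of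
`FluidPDE.lowFreqKernel` (`CheskidovShvydkoy`); the dilates `lowPassKernel κ` agree on
`EuclideanSpace` with `FluidPDE.mollifierScale κ⁻¹ g₁` (`DissipationAnomaly`), which is not reused
because it lives downstream in `FluidPDE/` and is Euclidean-only — the general-`E`, real-parameter
dilation with its `L¹`-mass / second-moment bookkeeping is the new material here.

## References

* H. Bahouri, J.-Y. Chemin, R. Danchin, *Fourier Analysis and Nonlinear PDE*, Springer 2011,
  §2.2 (proof of Lemma 2.1: kernels of dilated cut-offs). [BahouriCheminDanchin2011]
* T. Buckmaster, V. Vicol, Ann. of Math. 189 (2019) = arXiv:1709.10033, App. B. [BuckmasterVicol2019AnnMath]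
-/

noncomputable section

open MeasureTheory FourierTransform SchwartzMap Real Complex Filter Topology Function Metric
open scoped FourierTransform RealInnerProductSpace ComplexConjugate ENNReal ContDiff

namespace Literature.Analysis.Fourier

section Symbol

variable {E : Type*} [NormedAddCommGroup E] [InnerProductSpace ℝ E]

/-- The **low-pass symbol** `ℓ(ξ) = χ(4ξ)`, i.e. the tree's Littlewood–Paley cut-off symbol
`FunctionSpaces.lowFreqSymbol (-2) = χ(2^{2} ·)` of `Ṡ₋₂` (complex valued): `ℓ = 1` on
`‖ξ‖ ≤ 1/4`, `ℓ = 0` on `‖ξ‖ ≥ 1/2`. [folklore] -/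
def lowPassSymbol : E → ℂ := FunctionSpaces.lowFreqSymbol (-2)

/-- `ℓ` is the Littlewood–Paley symbol `χ(2^{2}·)` of `Ṡ₋₂` (by definition). [folklore] -/
theorem lowPassSymbol_eq_lowFreqSymbol : (lowPassSymbol : E → ℂ) = FunctionSpaces.lowFreqSymbol (-2) := rfl

/-- Unfolding: `ℓ(ξ) = χ(4ξ)`. [folklore] -/
theorem lowPassSymbol_apply (ξ : E) :
    lowPassSymbol ξ = ((FunctionSpaces.dyadicCutoff E) ((4 : ℝ) • ξ) : ℂ) := by
  simp only [lowPassSymbol, FunctionSpaces.lowFreqSymbol, neg_neg]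
  norm_num

/-- `ℓ(ξ) = 1` for `‖ξ‖ ≤ 1/4` (`= 2⁻²`; the tree's `lowFreqSymbol_eq_one_of_norm_le`). [folklore] -/
theorem lowPassSymbol_of_norm_le {ξ : E} (h : ‖ξ‖ ≤ 1 / 4) : lowPassSymbol ξ = 1 :=
  FunctionSpaces.lowFreqSymbol_eq_one_of_norm_le (j := -2) (by norm_num; linarith)

/-- `ℓ(ξ) = 0` for `1/2 ≤ ‖ξ‖` (`‖4ξ‖ ≥ 2`). [folklore] -/
theorem lowPassSymbol_of_le_norm {ξ : E} (h : 1 / 2 ≤ ‖ξ‖) : lowPassSymbol ξ = 0 := by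
  rw [lowPassSymbol_apply, FunctionSpaces.dyadicCutoff_apply_of_two_le_norm, Complex.ofReal_zero]
  rw [norm_smul, Real.norm_of_nonneg (by norm_num : (0 : ℝ) ≤ 4)]
  linarith

/-- `ℓ(0) = 1`. [folklore] -/
theorem lowPassSymbol_zero : lowPassSymbol (0 : E) = 1 :=
  lowPassSymbol_of_norm_le (by simp)

/-- The symbol is even. [folklore] -/
theorem lowPassSymbol_neg (ξ : E) : lowPassSymbol (-ξ) = lowPassSymbol ξ := by
  simp only [lowPassSymbol_apply, smul_neg, ContDiffBump.neg]

/-- The symbol is real. [folklore] -/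
theorem conj_lowPassSymbol (ξ : E) : conj (lowPassSymbol ξ) = lowPassSymbol ξ := by
  simp only [lowPassSymbol_apply, Complex.conj_ofReal]

/-- `‖ℓ(ξ)‖ ≤ 1` (the tree's `norm_lowFreqSymbol_le_one`). [folklore] -/
theorem norm_lowPassSymbol_le_one (ξ : E) : ‖lowPassSymbol ξ‖ ≤ 1 :=
  FunctionSpaces.norm_lowFreqSymbol_le_one (-2) ξ

/-- The symbol is smooth (the tree's `contDiff_lowFreqSymbol`). [folklore] -/
theorem contDiff_lowPassSymbol : ContDiff ℝ ∞ (lowPassSymbol : E → ℂ) :=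
  FunctionSpaces.contDiff_lowFreqSymbol (-2)

/-- The symbol is continuous. [folklore] -/
theorem continuous_lowPassSymbol : Continuous (lowPassSymbol : E → ℂ) :=
  contDiff_lowPassSymbol.continuous

/-- The symbol vanishes off the closed ball of radius `1/2`. [folklore] -/
theorem lowPassSymbol_eq_zero_of_not_mem {ξ : E} (h : ξ ∉ closedBall (0 : E) (1 / 2)) :
    lowPassSymbol ξ = 0 := by
  apply lowPassSymbol_of_le_norm
  rw [mem_closedBall, dist_zero_right, not_le] at h
  exact h.le

variable [FiniteDimensional ℝ E]

/-- The symbol has compact support (the tree's `hasCompactSupport_lowFreqSymbol`). [folklore] -/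
theorem hasCompactSupport_lowPassSymbol : HasCompactSupport (lowPassSymbol : E → ℂ) :=
  FunctionSpaces.hasCompactSupport_lowFreqSymbol (-2)

variable [MeasurableSpace E] [BorelSpace E]

variable (E) in
/-- The low-pass symbol as a Schwartz function: the tree's `FunctionSpaces.lowFreqSymbolSchwartz E (-2)`.
[folklore] -/
def lowPassSymbolSchwartz : 𝓢(E, ℂ) := FunctionSpaces.lowFreqSymbolSchwartz E (-2)

omit [MeasurableSpace E] [BorelSpace E] in
/-- `lowPassSymbolSchwartz E` is `lowFreqSymbolSchwartz E (-2)` (by definition). [folklore] -/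
theorem lowPassSymbolSchwartz_eq : lowPassSymbolSchwartz E = FunctionSpaces.lowFreqSymbolSchwartz E (-2) := rfl

omit [MeasurableSpace E] [BorelSpace E] in
/-- The Schwartz function is the symbol. [folklore] -/
@[simp]
theorem coe_lowPassSymbolSchwartz : ((lowPassSymbolSchwartz E : 𝓢(E, ℂ)) : E → ℂ) = lowPassSymbol :=
  FunctionSpaces.coe_lowFreqSymbolSchwartz (-2)

end Symbol

/-! ## The kernel at scale one -/

section KernelOne

variable {E : Type*} [NormedAddCommGroup E] [InnerProductSpace ℝ E] [FiniteDimensional ℝ E]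
  [MeasurableSpace E] [BorelSpace E]

variable (E) in
/-- The complex low-pass kernel `𝓕⁻¹ ℓ ∈ 𝓢(E, ℂ)`. [folklore] -/
def lowPassKernelC : 𝓢(E, ℂ) := 𝓕⁻ (lowPassSymbolSchwartz E : 𝓢(E, ℂ))

/-- The complex kernel as an inverse Fourier integral of the symbol. [folklore] -/
theorem lowPassKernelC_apply (x : E) : lowPassKernelC E x = 𝓕⁻ (lowPassSymbol (E := E)) x := by
  rw [lowPassKernelC, SchwartzMap.fourierInv_coe, coe_lowPassSymbolSchwartz]

/-- The complex kernel is real valued (`ℓ` is real and even). [folklore] -/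
theorem conj_lowPassKernelC (x : E) : conj (lowPassKernelC E x) = lowPassKernelC E x := by
  rw [lowPassKernelC_apply, Real.fourierInv_eq, ← integral_conj]
  have h : ∀ v : E, conj (𝐞 ⟪v, x⟫ • lowPassSymbol v) = 𝐞 ⟪-v, x⟫ • lowPassSymbol (-v) := by
    intro v
    rw [Circle.smul_def, Circle.smul_def, smul_eq_mul, smul_eq_mul, map_mul, conj_lowPassSymbol,
      lowPassSymbol_neg, ← Circle.coe_inv_eq_conj, ← AddChar.map_neg_eq_inv, inner_neg_left]
  simp_rw [h]
  exact integral_neg_eq_self (fun v => 𝐞 ⟪v, x⟫ • lowPassSymbol v) volume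

/-- The imaginary part of the complex kernel vanishes. [folklore] -/
theorem im_lowPassKernelC (x : E) : (lowPassKernelC E x).im = 0 :=
  Complex.conj_eq_iff_im.1 (conj_lowPassKernelC x)

/-- The complex kernel is even. [folklore] -/
theorem lowPassKernelC_neg (x : E) : lowPassKernelC E (-x) = lowPassKernelC E x := by
  rw [lowPassKernelC_apply, lowPassKernelC_apply, Real.fourierInv_eq, Real.fourierInv_eq]
  have h : ∀ v : E, 𝐞 ⟪v, -x⟫ • lowPassSymbol v = 𝐞 ⟪-v, x⟫ • lowPassSymbol (-(-v)) := by
    intro v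
    rw [neg_neg, inner_neg_right, inner_neg_left]
  simp_rw [h]
  have := integral_neg_eq_self (fun v => 𝐞 ⟪v, x⟫ • lowPassSymbol (-v)) volume
  simp only [neg_neg] at this ⊢
  rw [this]
  simp_rw [lowPassSymbol_neg]

/-- `𝓕 (𝓕⁻¹ ℓ) = ℓ` on Schwartz space. [folklore] -/
theorem fourier_lowPassKernelC : 𝓕 (lowPassKernelC E) = lowPassSymbolSchwartz E := by
  rw [lowPassKernelC, fourier_fourierInv_eq]

/-- The Fourier integral of the complex kernel is the symbol. [folklore] -/
theorem fourierIntegral_lowPassKernelC (ξ : E) :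
    𝓕 ((lowPassKernelC E : 𝓢(E, ℂ)) : E → ℂ) ξ = lowPassSymbol ξ := by
  rw [← SchwartzMap.fourier_coe, fourier_lowPassKernelC, coe_lowPassSymbolSchwartz]

/-- `∫ 𝓕⁻¹ℓ = ℓ(0) = 1`. [folklore] -/
theorem integral_lowPassKernelC : ∫ x, lowPassKernelC E x = 1 := by
  have h := fourierIntegral_lowPassKernelC (E := E) 0
  rw [lowPassSymbol_zero, Real.fourier_eq] at h
  simpa using h

variable (E) in
/-- The **real low-pass kernel at scale one**, `g₁ = Re 𝓕⁻¹ ℓ = 𝓕⁻¹ ℓ`. [folklore] -/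
def lowPassKernelOne (x : E) : ℝ := (lowPassKernelC E x).re

/-- `(g₁ x : ℂ) = 𝓕⁻¹ℓ (x)`. [folklore] -/
theorem ofReal_lowPassKernelOne (x : E) : ((lowPassKernelOne E x : ℝ) : ℂ) = lowPassKernelC E x := by
  conv_rhs => rw [← Complex.re_add_im (lowPassKernelC E x), im_lowPassKernelC]
  simp [lowPassKernelOne]

/-- The complex kernel is the real kernel, as functions. [folklore] -/
theorem coe_lowPassKernelC_eq :
    ((lowPassKernelC E : 𝓢(E, ℂ)) : E → ℂ) = fun x => ((lowPassKernelOne E x : ℝ) : ℂ) :=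
  funext fun x => (ofReal_lowPassKernelOne x).symm

/-- `g₁` is even. [folklore] -/
theorem lowPassKernelOne_neg (x : E) : lowPassKernelOne E (-x) = lowPassKernelOne E x := by
  rw [lowPassKernelOne, lowPassKernelC_neg, lowPassKernelOne]

/-- `g₁` is continuous. [folklore] -/
theorem continuous_lowPassKernelOne : Continuous (lowPassKernelOne E) :=
  Complex.continuous_re.comp (lowPassKernelC E).continuous

/-- `g₁` is smooth. [folklore] -/
theorem contDiff_lowPassKernelOne : ContDiff ℝ ∞ (lowPassKernelOne E) :=
  Complex.reCLM.contDiff.comp ((lowPassKernelC E).smooth ⊤)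

/-- `‖g₁ x‖ = ‖𝓕⁻¹ℓ (x)‖`. [folklore] -/
theorem norm_lowPassKernelOne (x : E) : ‖lowPassKernelOne E x‖ = ‖lowPassKernelC E x‖ := by
  rw [← ofReal_lowPassKernelOne, Complex.norm_real]

/-- `g₁` is integrable. [folklore] -/
theorem integrable_lowPassKernelOne : Integrable (lowPassKernelOne E) (volume : Measure E) := by
  have h := (lowPassKernelC E).integrable (μ := (volume : Measure E))
  exact (h.norm.mono' (continuous_lowPassKernelOne.aestronglyMeasurable)
    (Eventually.of_forall fun x => (norm_lowPassKernelOne x).le))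

/-- `g₁` is bounded. [folklore] -/
theorem exists_norm_lowPassKernelOne_le : ∃ C : ℝ, 0 ≤ C ∧ ∀ x, ‖lowPassKernelOne E x‖ ≤ C := by
  obtain ⟨C, hC0, hC⟩ := (lowPassKernelC E).decay 0 0
  refine ⟨C, hC0.le, fun x => ?_⟩
  rw [norm_lowPassKernelOne]
  simpa using hC x

/-- `∫ g₁ = 1`. [folklore] -/
theorem integral_lowPassKernelOne : ∫ x, lowPassKernelOne E x = 1 := by
  have h := integral_lowPassKernelC (E := E)
  rw [show (fun x => lowPassKernelC E x) = fun x => ((lowPassKernelOne E x : ℝ) : ℂ) from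
    coe_lowPassKernelC_eq, integral_complex_ofReal] at h
  exact_mod_cast h

/-- `𝓕 g₁ = ℓ`. [folklore] -/
theorem fourierIntegral_ofReal_lowPassKernelOne (ξ : E) :
    𝓕 (fun x => ((lowPassKernelOne E x : ℝ) : ℂ)) ξ = lowPassSymbol ξ := by
  rw [← coe_lowPassKernelC_eq, fourierIntegral_lowPassKernelC]

/-- `x ↦ ‖x‖² g₁(x)` is integrable (Schwartz decay). [folklore] -/
theorem integrable_norm_sq_mul_lowPassKernelOne :
    Integrable (fun x => ‖x‖ ^ 2 * lowPassKernelOne E x) (volume : Measure E) := by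
  have h := SchwartzMap.integrable_pow_mul (volume : Measure E) (lowPassKernelC E) 2
  refine h.mono' ?_ (Eventually.of_forall fun x => ?_)
  · exact ((continuous_norm.pow 2).mul continuous_lowPassKernelOne).aestronglyMeasurable
  · rw [norm_mul, norm_pow, norm_norm, norm_lowPassKernelOne]

variable (E) in
/-- The `L¹` mass `∫ |g₁|` of the low-pass kernel. [folklore] -/
def lowPassMass : ℝ := ∫ x : E, |lowPassKernelOne E x|

variable (E) in
/-- The absolute second moment `∫ ‖x‖² |g₁(x)| dx` of the low-pass kernel. [folklore] -/
def lowPassMoment : ℝ := ∫ x : E, ‖x‖ ^ 2 * |lowPassKernelOne E x|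

/-- `0 ≤ ∫ |g₁|`. [folklore] -/
theorem lowPassMass_nonneg : 0 ≤ lowPassMass E :=
  integral_nonneg fun _ => abs_nonneg _

/-- `1 ≤ ∫ |g₁|` (`1 = ∫ g₁ ≤ ∫ |g₁|`). [folklore] -/
theorem one_le_lowPassMass : 1 ≤ lowPassMass E := by
  rw [← integral_lowPassKernelOne (E := E), lowPassMass]
  have h := abs_integral_le_integral_abs (f := lowPassKernelOne E) (μ := (volume : Measure E))
  exact (le_abs_self _).trans h

/-- `0 ≤ ∫ ‖x‖² |g₁|`. [folklore] -/
theorem lowPassMoment_nonneg : 0 ≤ lowPassMoment E :=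
  integral_nonneg fun _ => mul_nonneg (sq_nonneg _) (abs_nonneg _)

/-- `|g₁|` is integrable. [folklore] -/
theorem integrable_abs_lowPassKernelOne :
    Integrable (fun x => |lowPassKernelOne E x|) (volume : Measure E) :=
  integrable_lowPassKernelOne.abs

/-- `‖x‖² |g₁(x)|` is integrable. [folklore] -/
theorem integrable_norm_sq_mul_abs_lowPassKernelOne :
    Integrable (fun x => ‖x‖ ^ 2 * |lowPassKernelOne E x|) (volume : Measure E) := by
  have h := integrable_norm_sq_mul_lowPassKernelOne (E := E)
  refine h.abs.congr (Eventually.of_forall fun x => ?_)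
  simp only [abs_mul, abs_pow, abs_norm]

end KernelOne

/-! ## The dilated kernels `g_κ(x) = κ^d g₁(κ x)` -/

section Kernel

variable {E : Type*} [NormedAddCommGroup E] [InnerProductSpace ℝ E] [FiniteDimensional ℝ E]
  [MeasurableSpace E] [BorelSpace E]

variable (E) in
/-- The **low-pass kernel at scale `κ`**: `g_κ(x) = κ^d g₁(κx)` (`d = dim E`), the
`L¹`-normalised dilate of `g₁`, with `𝓕 g_κ(ξ) = ℓ(ξ/κ) = χ(4ξ/κ)` for `κ > 0`. [folklore] -/
def lowPassKernel (κ : ℝ) (x : E) : ℝ := κ ^ Module.finrank ℝ E * lowPassKernelOne E (κ • x)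

/-- Unfolding. [folklore] -/
theorem lowPassKernel_apply (κ : ℝ) (x : E) :
    lowPassKernel E κ x = κ ^ Module.finrank ℝ E * lowPassKernelOne E (κ • x) := rfl

/-- At scale one the kernel is `g₁`. [folklore] -/
theorem lowPassKernel_one : lowPassKernel E 1 = lowPassKernelOne E := by
  funext x; simp [lowPassKernel_apply]

/-- `g_κ` is even. [folklore] -/
theorem lowPassKernel_neg (κ : ℝ) (x : E) : lowPassKernel E κ (-x) = lowPassKernel E κ x := by
  rw [lowPassKernel_apply, lowPassKernel_apply, smul_neg, lowPassKernelOne_neg]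

/-- `g_κ` is continuous. [folklore] -/
theorem continuous_lowPassKernel (κ : ℝ) : Continuous (lowPassKernel E κ) :=
  continuous_const.mul (continuous_lowPassKernelOne.comp (continuous_const_smul κ))

/-- `g_κ` is bounded by `κ^d sup |g₁|`. [folklore] -/
theorem exists_norm_lowPassKernel_le {κ : ℝ} (hκ : 0 ≤ κ) :
    ∃ C : ℝ, 0 ≤ C ∧ ∀ x, ‖lowPassKernel E κ x‖ ≤ C := by
  obtain ⟨C, hC0, hC⟩ := exists_norm_lowPassKernelOne_le (E := E)
  refine ⟨κ ^ Module.finrank ℝ E * C, mul_nonneg (pow_nonneg hκ _) hC0, fun x => ?_⟩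
  rw [lowPassKernel_apply, norm_mul, norm_pow, Real.norm_of_nonneg hκ]
  exact mul_le_mul_of_nonneg_left (hC _) (pow_nonneg hκ _)

/-- Change of variables for the dilates: `∫ F(κ x) g_κ-weighted` — the basic identity
`∫ κ^d h(κ x) dx = ∫ h` for `κ > 0`. [folklore] -/
theorem integral_pow_mul_comp_smul {F : Type*} [NormedAddCommGroup F] [NormedSpace ℝ F]
    (h : E → F) {κ : ℝ} (hκ : 0 < κ) :
    ∫ x, (κ ^ Module.finrank ℝ E) • h (κ • x) = ∫ x, h x := by
  rw [integral_smul, Measure.integral_comp_smul_of_nonneg volume h κ (hR := hκ.le), smul_smul,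
    mul_inv_cancel₀ (pow_ne_zero _ hκ.ne'), one_smul]

/-- `∫ g_κ = 1` for `κ > 0`. [folklore] -/
theorem integral_lowPassKernel {κ : ℝ} (hκ : 0 < κ) : ∫ x, lowPassKernel E κ x = 1 := by
  have h := integral_pow_mul_comp_smul (lowPassKernelOne E) hκ
  simp only [smul_eq_mul] at h
  rw [show (fun x => lowPassKernel E κ x) = fun x => κ ^ Module.finrank ℝ E * lowPassKernelOne E (κ • x)
    from rfl, h, integral_lowPassKernelOne]

/-- `∫ |g_κ| = ∫ |g₁|` for `κ > 0`. [folklore] -/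
theorem integral_abs_lowPassKernel {κ : ℝ} (hκ : 0 < κ) :
    ∫ x, |lowPassKernel E κ x| = lowPassMass E := by
  have h := integral_pow_mul_comp_smul (fun x => |lowPassKernelOne E x|) hκ
  simp only [smul_eq_mul] at h
  rw [lowPassMass, ← h]
  refine integral_congr_ae (Eventually.of_forall fun x => ?_)
  simp only [lowPassKernel_apply, abs_mul, abs_pow, abs_of_pos hκ]

/-- `∫ ‖x‖² |g_κ(x)| dx = κ⁻² ∫ ‖x‖² |g₁|` for `κ > 0`. [folklore] -/
theorem integral_norm_sq_mul_abs_lowPassKernel {κ : ℝ} (hκ : 0 < κ) :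
    ∫ x, ‖x‖ ^ 2 * |lowPassKernel E κ x| = (κ ^ 2)⁻¹ * lowPassMoment E := by
  have h := integral_pow_mul_comp_smul (fun x => ‖x‖ ^ 2 * |lowPassKernelOne E x|) hκ
  simp only [smul_eq_mul] at h
  rw [lowPassMoment, ← h, ← integral_const_mul]
  refine integral_congr_ae (Eventually.of_forall fun x => ?_)
  simp only [lowPassKernel_apply, abs_mul, abs_pow, abs_of_pos hκ, norm_smul, Real.norm_of_nonneg hκ.le]
  field_simp

/-- `g_κ` is integrable (`κ > 0`). [folklore] -/
theorem integrable_lowPassKernel {κ : ℝ} (hκ : 0 < κ) : Integrable (lowPassKernel E κ) (volume : Measure E) := by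
  have h : Integrable (fun x => lowPassKernelOne E (κ • x)) (volume : Measure E) :=
    (integrable_comp_smul_iff volume (lowPassKernelOne E) hκ.ne').2 integrable_lowPassKernelOne
  exact h.const_mul _

/-- `‖x‖² g_κ(x)` is integrable (`κ > 0`). [folklore] -/
theorem integrable_norm_sq_mul_lowPassKernel {κ : ℝ} (hκ : 0 < κ) :
    Integrable (fun x => ‖x‖ ^ 2 * lowPassKernel E κ x) (volume : Measure E) := by
  have h1 : Integrable (fun x => ‖κ • x‖ ^ 2 * lowPassKernelOne E (κ • x)) (volume : Measure E) :=
    (integrable_comp_smul_iff volume (fun y => ‖y‖ ^ 2 * lowPassKernelOne E y) hκ.ne').2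
      integrable_norm_sq_mul_lowPassKernelOne
  have h2 := h1.const_mul ((κ ^ 2)⁻¹ * κ ^ Module.finrank ℝ E)
  refine h2.congr (Eventually.of_forall fun x => ?_)
  simp only [lowPassKernel_apply, norm_smul, Real.norm_of_nonneg hκ.le]
  field_simp

/-- `‖x‖² |g_κ(x)|` is integrable (`κ > 0`). [folklore] -/
theorem integrable_norm_sq_mul_abs_lowPassKernel {κ : ℝ} (hκ : 0 < κ) :
    Integrable (fun x => ‖x‖ ^ 2 * |lowPassKernel E κ x|) (volume : Measure E) := by
  refine (integrable_norm_sq_mul_lowPassKernel hκ).abs.congr (Eventually.of_forall fun x => ?_)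
  simp only [abs_mul, abs_pow, abs_norm]

/-- **`𝓕 g_κ (ξ) = ℓ(ξ/κ)`** for `κ > 0` (`𝓕(h(κ·))(ξ) = κ^{-d} 𝓕h(ξ/κ)`). [folklore] -/
theorem fourierIntegral_ofReal_lowPassKernel {κ : ℝ} (hκ : 0 < κ) (ξ : E) :
    𝓕 (fun x => ((lowPassKernel E κ x : ℝ) : ℂ)) ξ = lowPassSymbol (κ⁻¹ • ξ) := by
  have h1 : 𝓕 (fun x => ((lowPassKernel E κ x : ℝ) : ℂ)) ξ =
      ((κ ^ Module.finrank ℝ E : ℝ) : ℂ) * 𝓕 (fun x => ((lowPassKernelOne E (κ • x) : ℝ) : ℂ)) ξ := by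
    rw [Real.fourier_eq, Real.fourier_eq, ← smul_eq_mul, ← integral_smul]
    refine integral_congr_ae (Eventually.of_forall fun v => ?_)
    simp only [lowPassKernel_apply, Complex.ofReal_mul, Complex.ofReal_pow, Circle.smul_def, smul_eq_mul]
    ring
  have h2 := FunctionSpaces.fourier_comp_smul (fun v => ((lowPassKernelOne E v : ℝ) : ℂ)) hκ.ne' ξ
  beta_reduce at h2
  rw [h1, h2, fourierIntegral_ofReal_lowPassKernelOne,
    abs_of_pos (inv_pos.2 (pow_pos hκ _)), Complex.real_smul, ← mul_assoc,
    ← Complex.ofReal_mul, mul_inv_cancel₀ (pow_ne_zero _ hκ.ne'), Complex.ofReal_one, one_mul]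

/-- `𝓕 g_κ (ξ) = 0` for `‖ξ‖ ≥ κ/2` (`κ > 0`). [folklore] -/
theorem fourierIntegral_ofReal_lowPassKernel_of_le_norm {κ : ℝ} (hκ : 0 < κ) {ξ : E}
    (h : κ / 2 ≤ ‖ξ‖) : 𝓕 (fun x => ((lowPassKernel E κ x : ℝ) : ℂ)) ξ = 0 := by
  rw [fourierIntegral_ofReal_lowPassKernel hκ]
  apply lowPassSymbol_of_le_norm
  rw [norm_smul, Real.norm_of_nonneg (inv_pos.2 hκ).le, le_inv_mul_iff₀ hκ]
  linarith

/-- `𝓕 g_κ (ξ) = 1` for `‖ξ‖ ≤ κ/4` (`κ > 0`). [folklore] -/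
theorem fourierIntegral_ofReal_lowPassKernel_of_norm_le {κ : ℝ} (hκ : 0 < κ) {ξ : E}
    (h : ‖ξ‖ ≤ κ / 4) : 𝓕 (fun x => ((lowPassKernel E κ x : ℝ) : ℂ)) ξ = 1 := by
  rw [fourierIntegral_ofReal_lowPassKernel hκ]
  apply lowPassSymbol_of_norm_le
  rw [norm_smul, Real.norm_of_nonneg (inv_pos.2 hκ).le, inv_mul_le_iff₀ hκ]
  linarith

/-- `‖𝓕 g_κ (ξ)‖ ≤ 1`. [folklore] -/
theorem norm_fourierIntegral_ofReal_lowPassKernel_le {κ : ℝ} (hκ : 0 < κ) (ξ : E) :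
    ‖𝓕 (fun x => ((lowPassKernel E κ x : ℝ) : ℂ)) ξ‖ ≤ 1 := by
  rw [fourierIntegral_ofReal_lowPassKernel hκ]
  exact norm_lowPassSymbol_le_one _

end Kernel

end Literature.Analysis.Fourier
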